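import Mathlib
import HarnessLib
import Literature.Combinatorics.LorentzianPolynomials.Rayleigh
import Summits.NavierStokesRegularity.NavierStokesRegularity.Theorems.UnthreadedRigidityDoorUnthreadedRigidityVirialHornTwoChannelDefs
import Summits.NavierStokesRegularity.NavierStokesRegularity.Theorems.UnthreadedRigidityDoorUnthreadedRigidityVirialHornBracketTwo

/-!
# Route `UnthreadedRigidityDoor`, item `UnthreadedRigidity` (W2, stmt-NavierStokesRegularity-27585) — LINE g11-1 «VIRIAL HORN»,
# BRIDGE V for PLATEAU PROFILES, file 1: THE CASCADE `F_k = Δᵏ(Y²)` of a solid harmonic (polynomial and function calculus)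

Prover file (W2 Lean hand ns-crc-p1 g10, by lineage; `--supports stmt-NavierStokesRegularity-27585 --as helper`; objects BY NAME in
`Theorems/UnthreadedRigidityDoorUnthreadedRigidityVirialHornTwoChannelDefs.lean`, p726708).

Content («TWO-CHANNEL RIGIDITY», step 0 — the triangular basis that replaces the spherical-harmonic decomposition):
* §1 polynomial identities: `lapP` lowers degree by two, the cascade `sqLapP P k = lapPᵏ(P·P)` is homogeneous of degree `2l − 2k` and stops
  (`F_{l+1} = 0`); `Δ(P²) = 2|∇P|² + 2PΔP`, the Bochner-type identity `Δ|∇P|² = 2|Hess P|² + 2∇P·∇ΔP` (third derivatives commute,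
  `Literature…pderiv_pderiv_comm`), hence `F₁ = 2|∇P|²`, `F₂ = 4·hessSqP` for harmonic `P`; `detP` of homogeneous polynomials is homogeneous;
* §2 the cascade as functions on `E3`: homogeneity `Q(cy) = c^n Q(y)`, Euler `DQ(y)·y = nQ(y)` (Mathlib's `IsHomogeneous.sum_X_mul_pderiv`),
  growth `|Q(y)| ≤ C|y|^n`, `Δ F_k = F_{k+1}` for Mathlib's Laplacian, `sqLapF (evalE P) k = evalE (sqLapP P k)`, the scaling of the brackets
  `{Y, F_k}`, and ★ `TwoChannel.coeff_eq_zero`: under `TwoChannel l Y` a combination `Σ_{k<l} θ_k {Y,F_k}` vanishing on a sphere of radius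
  `r > 0` has `θ₁ = θ₂ = 0` (the channel extraction used on every sphere `|y| = r` with `K(r) ≠ 0`).

HONEST LABEL: polynomial calculus; a piece of the L-part of ONE bridge of a RUNG line about SPECIAL (separable) slice data; `UnthreadedRigidity`
(27585), W2 and NS regularity remain OPEN; nothing here is a statement about Navier–Stokes dynamics.  0 kit.
-/

-- the summit and its single sub-problem share the name (CONVENTIONS §1), as in every Theorems file
set_option linter.dupNamespace false

namespace Summit.NavierStokesRegularity.NavierStokesRegularity.Theorems.UnthreadedRigidity.VirialHorn

open scoped RealInnerProductSpace Topology Laplacian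
open Filter Set MvPolynomial
open Literature.Combinatorics.LorentzianPolynomials (pderiv_pderiv_comm)
open Summit.NavierStokesRegularity.NavierStokesRegularity.Theorems.UnthreadedRigidity.ProfileHorn (E3)
open Summit.NavierStokesRegularity.NavierStokesRegularity.Theorems.PoloidalLiouville.HorizonTower hiding E3

/-! ## §1 Polynomial identities of the cascade -/

section Poly

variable {P φ : MvPolynomial (Fin 3) ℝ} {l n : ℕ}

/-- `lapP` as a sum over the three coordinates. -/
theorem lapP_eq_sum (φ : MvPolynomial (Fin 3) ℝ) : Zonal.lapP φ = ∑ i : Fin 3, pderiv i (pderiv i φ) := by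
  simp [Zonal.lapP, Fin.sum_univ_three]

/-- `dotP` as a sum over the three coordinates. -/
theorem dotP_eq_sum (a b : MvPolynomial (Fin 3) ℝ) : Zonal.dotP a b = ∑ i : Fin 3, pderiv i a * pderiv i b := by
  simp [Zonal.dotP, Fin.sum_univ_three]

/-- the Laplacian lowers the degree of a homogeneous polynomial by two. -/
theorem isHomogeneous_lapP (h : φ.IsHomogeneous n) : (Zonal.lapP φ).IsHomogeneous (n - 2) := by
  have h2 : ∀ i : Fin 3, (pderiv i (pderiv i φ)).IsHomogeneous (n - 2) := fun i => by
    have := (h.pderiv (i := i)).pderiv (i := i)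
    rwa [Nat.sub_sub] at this
  unfold Zonal.lapP
  exact ((h2 0).add (h2 1)).add (h2 2)

/-- a homogeneous polynomial of degree `0` has zero Laplacian. -/
theorem lapP_eq_zero_of_isHomogeneous_zero (h : φ.IsHomogeneous 0) : Zonal.lapP φ = 0 := by
  rw [← totalDegree_zero_iff_isHomogeneous, totalDegree_eq_zero_iff_eq_C] at h
  rw [h]
  simp [Zonal.lapP]

/-- `lapP 0 = 0`. -/
theorem lapP_zero : Zonal.lapP (0 : MvPolynomial (Fin 3) ℝ) = 0 := by simp [Zonal.lapP]

/-- step `0` of the cascade. -/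
theorem sqLapP_zero (P : MvPolynomial (Fin 3) ℝ) : sqLapP P 0 = P * P := rfl

/-- the cascade recursion `F_{k+1} = Δ F_k`. -/
theorem sqLapP_succ (P : MvPolynomial (Fin 3) ℝ) (k : ℕ) : sqLapP P (k + 1) = Zonal.lapP (sqLapP P k) :=
  Function.iterate_succ_apply' _ _ _

/-- `F_k` is homogeneous of degree `2l − 2k`. -/
theorem isHomogeneous_sqLapP (hP : P.IsHomogeneous l) (k : ℕ) : (sqLapP P k).IsHomogeneous (2 * l - 2 * k) := by
  induction k with
  | zero => simpa [sqLapP_zero, two_mul] using hP.mul hP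
  | succ k ih =>
    rw [sqLapP_succ, show 2 * l - 2 * (k + 1) = 2 * l - 2 * k - 2 by omega]
    exact isHomogeneous_lapP ih

/-- the cascade stops after `l` steps: `F_{l+1} = 0`. -/
theorem sqLapP_succ_self (hP : P.IsHomogeneous l) : sqLapP P (l + 1) = 0 := by
  rw [sqLapP_succ]
  apply lapP_eq_zero_of_isHomogeneous_zero
  simpa using isHomogeneous_sqLapP hP l

/-- … and stays zero: `F_k = 0` for every `k > l`. -/
theorem sqLapP_eq_zero_of_lt (hP : P.IsHomogeneous l) {k : ℕ} (hk : l < k) : sqLapP P k = 0 := by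
  obtain ⟨j, rfl⟩ : ∃ j, k = l + 1 + j := ⟨k - (l + 1), by omega⟩
  induction j with
  | zero => simpa using sqLapP_succ_self hP
  | succ j ih =>
    rw [← add_assoc, sqLapP_succ, ih (by omega), lapP_zero]

/-- Leibniz for the Laplacian of a square: `Δ(P²) = 2|∇P|² + 2PΔP`. -/
theorem lapP_mul_self (P : MvPolynomial (Fin 3) ℝ) :
    Zonal.lapP (P * P) = 2 * Zonal.dotP P P + 2 * P * Zonal.lapP P := by
  simp only [Zonal.lapP, Zonal.dotP, pderiv_mul, map_add]
  ring

/-- `F₁ = 2|∇P|²` for a harmonic `P`. -/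
theorem sqLapP_one (hlap : Zonal.lapP P = 0) : sqLapP P 1 = 2 * Zonal.dotP P P := by
  rw [sqLapP_succ, sqLapP_zero, lapP_mul_self, hlap, mul_zero, add_zero]

/-- third derivatives commute past the Laplacian: `∂ⱼ ΔP = Σᵢ ∂ᵢ∂ᵢ∂ⱼ P`. -/
theorem pderiv_lapP (P : MvPolynomial (Fin 3) ℝ) (j : Fin 3) :
    pderiv j (Zonal.lapP P) = ∑ i : Fin 3, pderiv i (pderiv i (pderiv j P)) := by
  rw [lapP_eq_sum, map_sum]
  refine Finset.sum_congr rfl fun i _ => ?_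
  rw [pderiv_pderiv_comm j i, pderiv_pderiv_comm j i]

/-- Bochner-type identity: `Δ|∇P|² = 2|Hess P|² + 2∇P·∇ΔP`. -/
theorem lapP_dotP_self (P : MvPolynomial (Fin 3) ℝ) :
    Zonal.lapP (Zonal.dotP P P) = 2 * hessSqP P + 2 * ∑ j : Fin 3, pderiv j P * pderiv j (Zonal.lapP P) := by
  have h1 : Zonal.lapP (Zonal.dotP P P) =
      ∑ i : Fin 3, ∑ j : Fin 3, (2 * (pderiv i (pderiv j P) * pderiv i (pderiv j P))
        + 2 * (pderiv j P * pderiv i (pderiv i (pderiv j P)))) := by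
    rw [lapP_eq_sum]
    refine Finset.sum_congr rfl fun i _ => ?_
    rw [dotP_eq_sum, map_sum, map_sum]
    refine Finset.sum_congr rfl fun j _ => ?_
    simp only [pderiv_mul, map_add]
    ring
  rw [h1, hessSqP]
  simp only [pderiv_lapP, Finset.mul_sum, Finset.sum_add_distrib]
  rw [Finset.sum_comm (f := fun j i => 2 * (pderiv j P * pderiv i (pderiv i (pderiv j P))))]

/-- the constant `2` is killed by `pderiv`. -/
theorem pderiv_two_mul (i : Fin 3) (q : MvPolynomial (Fin 3) ℝ) : pderiv i (2 * q) = 2 * pderiv i q := by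
  rw [show (2 : MvPolynomial (Fin 3) ℝ) = C 2 from (map_ofNat C 2).symm, pderiv_C_mul]

/-- `Δ(2q) = 2Δq`. -/
theorem lapP_two_mul (q : MvPolynomial (Fin 3) ℝ) : Zonal.lapP (2 * q) = 2 * Zonal.lapP q := by
  simp only [Zonal.lapP, pderiv_two_mul]
  ring

/-- `F₂ = 4|Hess P|²` for a harmonic `P`. -/
theorem sqLapP_two (hlap : Zonal.lapP P = 0) : sqLapP P 2 = 4 * hessSqP P := by
  rw [sqLapP_succ, sqLapP_one hlap, lapP_two_mul, lapP_dotP_self, hlap]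
  simp only [map_zero, mul_zero, Finset.sum_const_zero, add_zero]
  ring

/-- the triple product `detP a b` of homogeneous polynomials is homogeneous. -/
theorem isHomogeneous_detP {a b : MvPolynomial (Fin 3) ℝ} {m n : ℕ} (ha : a.IsHomogeneous m) (hb : b.IsHomogeneous n) :
    (Zonal.detP a b).IsHomogeneous (1 + (m - 1 + (n - 1))) := by
  have hp : ∀ i j : Fin 3, (pderiv i a * pderiv j b).IsHomogeneous (m - 1 + (n - 1)) := fun i j =>
    (ha.pderiv (i := i)).mul (hb.pderiv (i := j))
  have hx : ∀ i : Fin 3, (X i : MvPolynomial (Fin 3) ℝ).IsHomogeneous 1 := fun i => isHomogeneous_X ℝ i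
  unfold Zonal.detP
  exact (((hx 0).mul ((hp 1 2).sub (hp 2 1))).add ((hx 1).mul ((hp 2 0).sub (hp 0 2)))).add
    ((hx 2).mul ((hp 0 1).sub (hp 1 0)))

end Poly

/-! ## §2 The cascade as functions on `E3` -/

section Fun

variable {P Q : MvPolynomial (Fin 3) ℝ} {l n : ℕ}

/-- `evalE` of a finite sum. -/
theorem evalE_sum {ι : Type*} (s : Finset ι) (f : ι → MvPolynomial (Fin 3) ℝ) (y : E3) :
    Zonal.evalE (∑ i ∈ s, f i) y = ∑ i ∈ s, Zonal.evalE (f i) y := by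
  simp [Zonal.evalE, map_sum]

/-- HOMOGENEITY: `Q(c y) = c^n Q(y)`. -/
theorem evalE_smul_of_isHomogeneous (hQ : Q.IsHomogeneous n) (c : ℝ) (y : E3) :
    Zonal.evalE Q (c • y) = c ^ n * Zonal.evalE Q y := by
  unfold Zonal.evalE
  have harg : (fun i => (c • y) i) = c • (fun i => y i) := by
    funext i; simp
  rw [harg, MvPolynomial.eval_eq', MvPolynomial.eval_eq', Finset.mul_sum]
  refine Finset.sum_congr rfl fun α hα => ?_
  have hdeg : ∑ i, α i = n := by
    rw [← Finsupp.degree_eq_sum, Finsupp.degree_apply]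
    exact (hQ.degree_eq_sum_deg_support hα).symm
  simp_rw [Pi.smul_apply, smul_eq_mul, mul_pow, Finset.prod_mul_distrib, Finset.prod_pow_eq_pow_sum, hdeg]
  ring

/-- EULER: `DQ(y)·y = n Q(y)`. -/
theorem fderiv_evalE_apply_self_of_isHomogeneous (hQ : Q.IsHomogeneous n) (y : E3) :
    fderiv ℝ (Zonal.evalE Q) y y = n * Zonal.evalE Q y := by
  have h := congrArg (fun φ => Zonal.evalE φ y) hQ.sum_X_mul_pderiv
  have hn : Zonal.evalE (n : MvPolynomial (Fin 3) ℝ) y = n := by simp [Zonal.evalE]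
  simp only [evalE_sum, Zonal.evalE_mul, Zonal.evalE_X, nsmul_eq_mul, hn] at h
  rw [Zonal.fderiv_evalE_apply, ← h]
  exact Finset.sum_congr rfl fun i _ => by ring

/-- GROWTH: `|Q(y)| ≤ C |y|^n`. -/
theorem exists_bound_evalE_of_isHomogeneous (hQ : Q.IsHomogeneous n) :
    ∃ C : ℝ, 0 ≤ C ∧ ∀ y : E3, |Zonal.evalE Q y| ≤ C * ‖y‖ ^ n := by
  classical
  refine ⟨∑ d ∈ Q.support, |coeff d Q|, Finset.sum_nonneg fun _ _ => abs_nonneg _, fun y => ?_⟩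
  -- `|yᵢ| ≤ |y|` (a local copy of a standard coordinate bound; kept as a `have` on purpose)
  have hcoord : ∀ i : Fin 3, |y i| ≤ ‖y‖ := by
    intro i
    have h2 : ‖y‖ ^ 2 = ∑ j : Fin 3, y j ^ 2 := by
      rw [EuclideanSpace.norm_eq, Real.sq_sqrt (Finset.sum_nonneg fun j _ => by positivity)]
      simp [Real.norm_eq_abs, sq_abs]
    have hi : y i ^ 2 ≤ ‖y‖ ^ 2 := by
      rw [h2]
      exact Finset.single_le_sum (f := fun j => y j ^ 2) (fun j _ => sq_nonneg _) (Finset.mem_univ i)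
    exact abs_le_of_sq_le_sq (by simpa using hi) (norm_nonneg y)
  unfold Zonal.evalE
  rw [MvPolynomial.eval_eq', Finset.sum_mul]
  refine (Finset.abs_sum_le_sum_abs _ _).trans (Finset.sum_le_sum fun d hd => ?_)
  have hdeg : ∑ i, d i = n := by
    rw [← Finsupp.degree_eq_sum, Finsupp.degree_apply]
    exact (hQ.degree_eq_sum_deg_support hd).symm
  rw [abs_mul, Finset.abs_prod]
  refine mul_le_mul_of_nonneg_left ?_ (abs_nonneg _)
  calc ∏ i, |y i ^ d i| = ∏ i, |y i| ^ d i := Finset.prod_congr rfl fun i _ => abs_pow _ _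
    _ ≤ ∏ i : Fin 3, ‖y‖ ^ d i :=
        Finset.prod_le_prod (fun i _ => by positivity) fun i _ => pow_le_pow_left₀ (abs_nonneg _) (hcoord i) _
    _ = ‖y‖ ^ n := by rw [Finset.prod_pow_eq_pow_sum, hdeg]

/-- `F₀ = Y²` as functions. -/
theorem evalE_sqLapP_zero (P : MvPolynomial (Fin 3) ℝ) (y : E3) : Zonal.evalE (sqLapP P 0) y = Zonal.evalE P y ^ 2 := by
  rw [sqLapP_zero, Zonal.evalE_mul, sq]

/-- `F₁ = 2|∇Y|²` as functions (`P` harmonic). -/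
theorem evalE_sqLapP_one (hlap : Zonal.lapP P = 0) (y : E3) :
    Zonal.evalE (sqLapP P 1) y = 2 * ‖gradient (Zonal.evalE P) y‖ ^ 2 := by
  rw [sqLapP_one hlap, congrFun (Zonal.norm_gradient_sq_evalE P) y, Zonal.evalE_mul]
  norm_num [Zonal.evalE]

/-- `F₂ = 4 Σᵢⱼ (∂ᵢ∂ⱼY)²` as functions (`P` harmonic). -/
theorem evalE_sqLapP_two (hlap : Zonal.lapP P = 0) (y : E3) :
    Zonal.evalE (sqLapP P 2) y = 4 * ∑ i : Fin 3, ∑ j : Fin 3, Zonal.evalE (pderiv i (pderiv j P)) y ^ 2 := by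
  rw [sqLapP_two hlap, Zonal.evalE_mul, hessSqP, evalE_sum]
  simp only [evalE_sum, Zonal.evalE_mul, sq]
  norm_num [Zonal.evalE]

/-- the Laplacian climbs the cascade: `Δ F_k = F_{k+1}`. -/
theorem laplacian_evalE_sqLapP (P : MvPolynomial (Fin 3) ℝ) (k : ℕ) (y : E3) :
    (Δ (Zonal.evalE (sqLapP P k))) y = Zonal.evalE (sqLapP P (k + 1)) y := by
  rw [sqLapP_succ, Zonal.laplacian_evalE]

/-- EULER on the cascade: `DF_k(y)·y = (2l−2k) F_k(y)`. -/
theorem fderiv_sqLapP_apply_self (hP : P.IsHomogeneous l) (k : ℕ) (y : E3) :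
    fderiv ℝ (Zonal.evalE (sqLapP P k)) y y = ((2 * l - 2 * k : ℕ) : ℝ) * Zonal.evalE (sqLapP P k) y :=
  fderiv_evalE_apply_self_of_isHomogeneous (isHomogeneous_sqLapP hP k) y

/-- the function cascade of a polynomial function is the polynomial cascade: `lap3ᵏ((evalE P)²) = evalE (lapPᵏ (P·P))`. -/
theorem sqLapF_evalE (P : MvPolynomial (Fin 3) ℝ) (k : ℕ) : sqLapF (Zonal.evalE P) k = Zonal.evalE (sqLapP P k) := by
  have hsq : (fun y : E3 => Zonal.evalE P y ^ 2) = Zonal.evalE (P * P) := by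
    funext y; rw [Zonal.evalE_mul, sq]
  have hsemi : Function.Semiconj Zonal.evalE Zonal.lapP lap3 := fun p => by
    funext y; exact (lap3_evalE p y).symm
  unfold sqLapF sqLapP
  rw [hsq]
  exact ((hsemi.iterate_right k) (P * P)).symm

/-- the bracket `{Y, F_k}` of the cascade is the polynomial `detP P (sqLapP P k)`. -/
theorem pbr_sqLapF_evalE (P : MvPolynomial (Fin 3) ℝ) (k : ℕ) (y : E3) :
    pbr (Zonal.evalE P) (sqLapF (Zonal.evalE P) k) y = Zonal.evalE (Zonal.detP P (sqLapP P k)) y := by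
  rw [sqLapF_evalE, pbr_evalE]

/-- SCALING OF THE BRACKETS: `{Y,F_k}(c y) = c^{d_k} {Y,F_k}(y)` with `d_k = 1 + ((l−1) + (2l−2k−1))`. -/
theorem pbr_sqLapF_smul (hP : P.IsHomogeneous l) (k : ℕ) (c : ℝ) (y : E3) :
    pbr (Zonal.evalE P) (sqLapF (Zonal.evalE P) k) (c • y) =
      c ^ (1 + (l - 1 + (2 * l - 2 * k - 1))) * pbr (Zonal.evalE P) (sqLapF (Zonal.evalE P) k) y := by
  rw [pbr_sqLapF_evalE, pbr_sqLapF_evalE]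
  exact evalE_smul_of_isHomogeneous (isHomogeneous_detP hP (isHomogeneous_sqLapP hP k)) c y

/-- ★ CHANNEL EXTRACTION: under `TwoChannel l Y`, a combination `Σ_{k<l} θ_k {Y,F_k}` vanishing on a sphere of radius `r > 0`
has `θ₁ = θ₂ = 0`. -/
theorem TwoChannel.coeff_eq_zero {Y : E3 → ℝ} (hY : IsSolidHarmonic l Y) (h2 : TwoChannel l Y) {r : ℝ} (hr : 0 < r)
    (θ : ℕ → ℝ) (hθ : ∀ y : E3, ‖y‖ = r → ∑ k ∈ Finset.range l, θ k * pbr Y (sqLapF Y k) y = 0) :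
    θ 1 = 0 ∧ θ 2 = 0 := by
  obtain ⟨P, hP, -, rfl⟩ := hY.exists_evalE
  set d : ℕ → ℕ := fun k => 1 + (l - 1 + (2 * l - 2 * k - 1)) with hd
  have key := h2 (fun k => θ k * r ^ d k) fun y hy => by
    have hry : ‖r • y‖ = r := by rw [norm_smul, Real.norm_eq_abs, abs_of_pos hr, hy, mul_one]
    have := hθ (r • y) hry
    simp only [pbr_sqLapF_smul hP] at this
    rw [← this]
    exact Finset.sum_congr rfl fun k _ => by ring
  have hr1 : r ^ d 1 ≠ 0 := pow_ne_zero _ hr.ne'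
  have hr2 : r ^ d 2 ≠ 0 := pow_ne_zero _ hr.ne'
  exact ⟨(mul_eq_zero.1 key.1).resolve_right hr1, (mul_eq_zero.1 key.2).resolve_right hr2⟩

end Fun

end Summit.NavierStokesRegularity.NavierStokesRegularity.Theorems.UnthreadedRigidity.VirialHorn
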